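import Mathlib
import Summits.Ventures.PercRepro2.OStarGlue
import Summits.Ventures.PercRepro2.A3BStarCert

/-!
# The gluing lemma for the star of `o` with the slots `a₃, a₁, b`, and row 2′TRI when `o` is
adjacent only to `a₃, b` (blind cell PercRepro2, mine-2 g39, 2026-08-28; `proofs/MINE2-GLUE.md`
§7, row M2-83)

`OStarGlue.lean` with the marks read in the order `a₃, a₁, a₂, b`: the star at `o` with its edges
confined to `a₃, a₁, b` is the structure `Star ends o a₃ a₁ a₂ b e₁ e₂ eb` of that file, the rest's
pattern `pat ends o a₃ a₁ a₂ b x` lives on `a₃, a₁, a₂, b`, and the state of a copy is the glued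
state `S3` of `A3BStarModel.lean` (`Star.st_eq_S3`).  The certificate `C3_nonneg` covers the
typings with the middle slot `o–a₁` ABSENT (`e₂ = none`; with an edge `o–a₁` of type `2` the gadget
sums change sign, `proofs/MINE2-GADGET.md` §7), so the theorems are stated for that family.
**`typedCount_nonneg_of_a3bstar`**, **`TypedBases_of_a3bstar`**, **`HCov_of_a3bstar`**: row 2′TRI
and (HCOV) for every admissible weight vector on every finite graph in which every edge at `o`
leads to `a₃` or `b` (at most one edge to each) — the `o`-pattern `{a₃, b}` of
`proofs/MINE2-GADGET.md` §7 (and `{a₃}`, `{b}`).  Own code; standard axioms.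
-/

namespace Summit.Ventures.PercRepro2

open UnionCluster

namespace CovForm

namespace OStar

open OneTyped Untouched TypedFactor SepThree TypedRed StarGlue

section A3BMain

variable {V : Type*} {E : Type*} [Fintype E] [DecidableEq V] [DecidableEq E]
variable {ends : E → Sym2 V} {o a₁ a₂ a₃ b : V} [DecidablePred (· ∈ (touches ends {o})ᶜ)]
  {e₁ eb : Option E} {R : Type*} [Field R] [LinearOrder R] [IsStrictOrderedRing R]

omit [Fintype E] [DecidableEq V] [DecidableEq E] [LinearOrder R] [IsStrictOrderedRing R] in
/-- **The gluing lemma for states, slots `a₃, a₁, b`**: the state of a copy is the glued state `S3`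
of the rest's pattern on `a₃, a₁, a₂, b` and the open-neighbour set `(o–a₃, o–a₁, o–b)`. -/
theorem Star.st_eq_S3 (hS : Star ends o a₃ a₁ a₂ b e₁ none eb) (x : Config E) :
    st ends o a₁ a₂ a₃ b x = S3 (pat ends o a₃ a₁ a₂ b x) (nbr e₁ none eb x) := by
  unfold st S3
  simp only [Prod.mk.injEq]
  refine ⟨?_, ?_, ?_, ?_, ?_, ?_, ?_⟩
  · exact Bool.eq_iff_iff.2 (by simp only [decide_eq_true_eq]; exact (hS.connG_iff x 2 1).symm)
  · exact Bool.eq_iff_iff.2 (by simp only [decide_eq_true_eq]; exact (hS.reach_iff_conn x 1).symm)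
  · exact Bool.eq_iff_iff.2 (by simp only [decide_eq_true_eq]; exact (hS.reach_iff_conn x 2).symm)
  · exact Bool.eq_iff_iff.2 (by simp only [decide_eq_true_eq]; exact (hS.connG_iff x 1 3).symm)
  · exact Bool.eq_iff_iff.2 (by simp only [decide_eq_true_eq]; exact (hS.connG_iff x 2 3).symm)
  · exact Bool.eq_iff_iff.2 (by simp only [decide_eq_true_eq]; exact (hS.connG_iff x 1 0).symm)
  · exact Bool.eq_iff_iff.2 (by simp only [decide_eq_true_eq]; exact (hS.connG_iff x 2 0).symm)

variable (ends o a₁ a₂ a₃ b e₁ eb)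

/-- The kernel on the side restrictions of the star with the slots `a₃, a₁, b`: `KB` on the glued
`S3`-states. -/
noncomputable def Φ3 : Config E → Config E → Config E → Config E → Config E → Config E → R :=
  fun xa ya wa xb yb wb =>
    ((KB (S3 (pat ends o a₃ a₁ a₂ b xb) (nbr e₁ none eb xa))
      (S3 (pat ends o a₃ a₁ a₂ b yb) (nbr e₁ none eb ya))
      (S3 (pat ends o a₃ a₁ a₂ b wb) (nbr e₁ none eb wa)) : ℤ) : R)

variable {ends o a₁ a₂ a₃ b e₁ eb}

omit [Fintype E] [LinearOrder R] [IsStrictOrderedRing R] in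
/-- **`K₃` on the support is the side kernel of `Φ3`** (`A` = the typed edges at `o`). -/
theorem K3_eq_side_3 (hS : Star ends o a₃ a₁ a₂ b e₁ none eb) (F : Finset E) (z : Config E)
    {x y w : Config E} (hx : ∀ e, e ∉ F → x e = z e) (hy : ∀ e, e ∉ F → y e = z e)
    (hw : ∀ e, e ∉ F → w e = z e) :
    (K3 ends o a₁ a₂ a₃ b x y w : R) =
      sideKernel (sideA ends o F) (sideB ends o F) z (Φ3 ends o a₁ a₂ a₃ b e₁ eb) x y w := by
  rw [K3_eq_KB, hS.st_eq_S3 x, hS.st_eq_S3 y, hS.st_eq_S3 w]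
  unfold sideKernel Φ3
  rw [nbr_restr_sideA hS hx, nbr_restr_sideA hS hy, nbr_restr_sideA hS hw, pat_restr_sideB hx,
    pat_restr_sideB hy, pat_restr_sideB hw]

omit [Fintype E] [DecidableEq V] [DecidableEq E] [LinearOrder R] [IsStrictOrderedRing R] in
/-- The `B`-symmetrisation of `Φ3` is `PSYM3`. -/
lemma symB_Φ3 (xa ya wa xb yb wb : Config E) :
    symB (Φ3 ends o a₁ a₂ a₃ b e₁ eb) xa ya wa xb yb wb =
      ((PSYM3 (nbr e₁ none eb xa) (nbr e₁ none eb ya) (nbr e₁ none eb wa) (pat ends o a₃ a₁ a₂ b xb)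
        (pat ends o a₃ a₁ a₂ b yb) (pat ends o a₃ a₁ a₂ b wb) : ℤ) : R) := by
  unfold symB Φ3 PSYM3
  push_cast
  ring

omit [Fintype E] [DecidableEq V] [DecidableEq E] [DecidablePred (· ∈ (touches ends {o})ᶜ)]
  [LinearOrder R] [IsStrictOrderedRing R] in
/-- The cast of the gadget sum `C3` is the `plc` sum of the casts. -/
lemma cast_C3 (t₁ t₂ tb : ℕ) (P₁ P₂ P₃ : Pat) :
    ((C3 t₁ t₂ tb P₁ P₂ P₃ : ℤ) : R) =
      ((plc t₁).map fun c₁ => ((plc t₂).map fun c₂ => ((plc tb).map fun cb =>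
        ((PSYM3 (c₁.1, c₂.1, cb.1) (c₁.2.1, c₂.2.1, cb.2.1) (c₁.2.2, c₂.2.2, cb.2.2)
          P₁ P₂ P₃ : ℤ) : R)).sum).sum).sum := by
  simp only [C3, Int.cast_list_sum, List.map_map, Function.comp_def]

omit [LinearOrder R] [IsStrictOrderedRing R] in
/-- **THE GLUING THEOREM, slots `a₃, a₁, b`**: six times the typed count of `K₃` is the sum, over the typed
triples of the rest, of the gadget sum `C3` of the star's typing at the rest's pattern triple. -/
theorem six_mul_typedCount_eq_3 (hS : Star ends o a₃ a₁ a₂ b e₁ none eb) (F : Finset E)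
    (z : Config E) (τ : E → ℕ) :
    6 * typedCount F z τ (K3 ends o a₁ a₂ a₃ b : Config E → Config E → Config E → R) =
      ∑ xb : Config E, ∑ yb : Config E, ∑ wb : Config E,
        if cond (sideB ends o F) z τ xb yb wb then
          ((C3 (typ e₁ (sideA ends o F) z τ) (typ none (sideA ends o F) z τ)
            (typ eb (sideA ends o F) z τ) (pat ends o a₃ a₁ a₂ b xb) (pat ends o a₃ a₁ a₂ b yb)
            (pat ends o a₃ a₁ a₂ b wb) : ℤ) : R)
        else 0 := by
  have hside : typedCount F z τ (K3 ends o a₁ a₂ a₃ b : Config E → Config E → Config E → R) =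
      typedCount F z τ (sideKernel (sideA ends o F) (sideB ends o F) z
        (Φ3 ends o a₁ a₂ a₃ b e₁ eb)) :=
    typedCount_congr_on_support F z τ fun x y w hc _ =>
      K3_eq_side_3 hS F z (fun e he => (hc e he).1) (fun e he => (hc e he).2.1)
        (fun e he => (hc e he).2.2)
  rw [hside, six_mul_typedCount_sideB F (sideB_subset F) (disjoint_sideA_sideB F) z τ]
  have hU := typedCount_eq_sum_AB (sideA ends o F) (sideB ends o F) (disjoint_sideA_sideB F) z τ
    (sideKernel (sideA ends o F) (sideB ends o F) z
      (symB (Φ3 (R := R) ends o a₁ a₂ a₃ b e₁ eb)))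
  rw [sideA_union_sideB] at hU
  rw [hU]
  refine Finset.sum_congr rfl fun xb _ => Finset.sum_congr rfl fun yb _ =>
    Finset.sum_congr rfl fun wb _ => ?_
  by_cases hB : cond (sideB ends o F) z τ xb yb wb
  · rw [if_pos hB]
    have hinner : ∀ xa ya wa : Config E,
        (if cond (sideA ends o F) z τ xa ya wa ∧ cond (sideB ends o F) z τ xb yb wb then
          sideKernel (sideA ends o F) (sideB ends o F) z (symB (Φ3 ends o a₁ a₂ a₃ b e₁ eb))
            (merge (sideA ends o F) (sideB ends o F) z xa xb)
            (merge (sideA ends o F) (sideB ends o F) z ya yb)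
            (merge (sideA ends o F) (sideB ends o F) z wa wb) else 0) =
        if cond (sideA ends o F) z τ xa ya wa then
          ((PSYM3 (nbr e₁ none eb xa) (nbr e₁ none eb ya) (nbr e₁ none eb wa) (pat ends o a₃ a₁ a₂ b xb)
            (pat ends o a₃ a₁ a₂ b yb) (pat ends o a₃ a₁ a₂ b wb) : ℤ) : R) else 0 := by
      intro xa ya wa
      by_cases hA : cond (sideA ends o F) z τ xa ya wa
      · rw [if_pos ⟨hA, hB⟩, if_pos hA]
        unfold sideKernel
        rw [restr_merge_left (fun e he => (hA.1 e he).1), restr_merge_left (fun e he => (hA.1 e he).2.1),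
          restr_merge_left (fun e he => (hA.1 e he).2.2),
          restr_merge_right (disjoint_sideA_sideB F) (fun e he => (hB.1 e he).1),
          restr_merge_right (disjoint_sideA_sideB F) (fun e he => (hB.1 e he).2.1),
          restr_merge_right (disjoint_sideA_sideB F) (fun e he => (hB.1 e he).2.2), symB_Φ3]
      · rw [if_neg (fun h => hA h.1), if_neg hA]
    refine (Finset.sum_congr rfl fun xa _ => Finset.sum_congr rfl fun ya _ =>
      Finset.sum_congr rfl fun wa _ => hinner xa ya wa).trans ?_
    rw [← typedCount_eq_sum_cond, typedCount_star_eq hS (fun e he => (mem_sideA.1 he).2) z τ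
      (fun N₁ N₂ N₃ => ((PSYM3 N₁ N₂ N₃ (pat ends o a₃ a₁ a₂ b xb) (pat ends o a₃ a₁ a₂ b yb)
        (pat ends o a₃ a₁ a₂ b wb) : ℤ) : R)), cast_C3]
  · rw [if_neg hB]
    refine Finset.sum_eq_zero fun xa _ => Finset.sum_eq_zero fun ya _ =>
      Finset.sum_eq_zero fun wa _ => ?_
    rw [if_neg (fun h => hB h.2)]

/-- **Row 2′TRI on the family `N(o) ⊆ {a₃, b}`**: when every edge at `o` leads to `a₃` or `b` (at most
one edge to each), every typed base of `K₃` is nonnegative. -/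
theorem typedCount_nonneg_of_a3bstar (hS : Star ends o a₃ a₁ a₂ b e₁ none eb) (F : Finset E)
    (z : Config E) (τ : E → ℕ) (hτ : ∀ e ∈ F, τ e = 1 ∨ τ e = 2) :
    0 ≤ typedCount F z τ (K3 ends o a₁ a₂ a₃ b : Config E → Config E → Config E → R) := by
  have h6 : 0 ≤ 6 * typedCount F z τ (K3 ends o a₁ a₂ a₃ b : Config E → Config E → Config E → R) := by
    rw [six_mul_typedCount_eq_3 hS F z τ]
    refine Finset.sum_nonneg fun xb _ => Finset.sum_nonneg fun yb _ =>
      Finset.sum_nonneg fun wb _ => ?_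
    split_ifs
    · exact Int.cast_nonneg (C3_nonneg (typ_le_three hτ e₁) (typ_le_three hτ eb) (valid_pat xb)
        (valid_pat yb) (valid_pat wb))
    · exact le_refl 0
  exact (mul_nonneg_iff_of_pos_left (by norm_num : (0 : R) < 6)).1 h6

/-- **The typed bases on the family `N(o) ⊆ {a₃, b}`** (row 2′TRI as a class theorem). -/
theorem TypedBases_of_a3bstar (hS : Star ends o a₃ a₁ a₂ b e₁ none eb) :
    TypedBases (R := R) ends o a₁ a₂ a₃ b :=
  fun F z τ hτ => typedCount_nonneg_of_a3bstar hS F z τ hτ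

/-- **(HCOV) on the family `N(o) ⊆ {a₃, b}`** for every admissible weight vector. -/
theorem HCov_of_a3bstar (hS : Star ends o a₃ a₁ a₂ b e₁ none eb) (p : E → R) (hp : IsProbVec p) :
    HCov p ends o a₁ a₂ a₃ b :=
  HCov_of_typedBases ends o a₁ a₂ a₃ b (TypedBases_of_a3bstar hS) p hp

end A3BMain

end OStar

end CovForm

end Summit.Ventures.PercRepro2
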